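import Summits.PneNP.PneNP.Theorems.ChebyshevTracialDesignLevelCountFooling
import HarnessLib

/-!
# Cell pnp-psdrank, route `ChebyshevTracialDesign`: the level-count obstruction (N3) — part 2, the obstruction

See part 1 (`ChebyshevTracialDesignLevelCountFooling`) for the setting and the fooling matrix `T = P(cc)²`.
Here: `levelCount_obstruction` (a weight `W` supported on `ℓ` crossing levels `L`, `1 ∉ L`, levels `≤ n`, with
`⟨W,S⟩ ≥ 0` admits a tight-orthogonal psd rectangle of dimension `r ≤ (ℓ+1)(n+1)^{2ℓ}` and normalised tracial value
`≥ ⟨W,S⟩/((ℓ+1)^5 (n+1)^{8ℓ+3})`), its reading as the FAILURE of tracial decay in dimension `n^{O(ℓ)}`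
(`not_tracialValueLEAt_of_levels`), and the instance for the route's multilevel design weights `levelWeight n t L w`
(`levelWeight_fooled`: `⟨W,S⟩ = Σ_c w_c (c−1)`, `= 1` for exact designs). Planner p1's N3 (ROUND-1 §3, referee-CONFIRMED;
mechanism Fawzi–Gouveia–Parrilo–Robinson–Thomas §5.2 Hadamard square roots, formulation the cell's): a hyperplane /
tracial certificate whose weight lives on `ℓ` crossing levels excludes psd factorizations of size `n^{O(ℓ)}` only —
the literal noncommutative lift of Rothvoß's two-level certificate (`ℓ = 2`; the Gribling–de Laat–Laurent question) is
polynomially capped, and exponential-type tracial bounds must charge `ℓ ≳ n^δ / log n` levels.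
WHAT THIS IS NOT: not a bound on the psd rank of the matching polytope in either direction; a limit of ONE template.
-/

set_option linter.dupNamespace false -- `Summit.PneNP.PneNP.…`: summit = sub-problem (D-0017)

noncomputable section

open scoped Classical MatrixOrder

namespace Summit.PneNP.PneNP.Theorems.ChebyshevTracialDesignLevelCount

open Finset Matrix Polynomial Literature.Barriers.PneNP Literature.Combinatorics.Optimization
  Literature.Computation.Certificates.SemidefiniteComplementarity

variable {n : ℕ}

/-! ### §6 The obstruction -/

/-- **Level-count obstruction (N3), positive form.** A weight supported on the crossing levels `L`
(`1 ∉ L`, levels `≤ n`) is paired against the odd-cut slack exactly as against the fooling matrix, so there is a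
tight-orthogonal psd rectangle of dimension `r ≤ (|L|+1)(n+1)^{2|L|}` whose normalised tracial value is at least
`⟨W, S⟩ / (r³ Δ_T)`, hence (for `⟨W,S⟩ ≥ 0`) at least `⟨W, S⟩ / ((|L|+1)^5 (n+1)^{8|L|+3})`. -/
theorem levelCount_obstruction (L : Finset ℕ) (h1 : 1 ∉ L) (hLn : ∀ c ∈ L, c ≤ n)
    (W : OddSet n → PMatch n → ℝ) (hW : ∀ U M, cc U M ∉ L → W U M = 0)
    (hpos : 0 ≤ ∑ U, ∑ M, W U M * pmOddCutSlack n U M) :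
    ∃ r : ℕ, 0 < r ∧ (r : ℝ) ≤ (L.card + 1) * ((n : ℝ) + 1) ^ (2 * L.card) ∧
      ∃ (X : OddSet n → Matrix (Fin r) (Fin r) ℝ) (Y : PMatch n → Matrix (Fin r) (Fin r) ℝ),
        IsPsdRect X Y ∧
        (∑ U, ∑ M, W U M * pmOddCutSlack n U M) /
            (((L.card : ℝ) + 1) ^ 5 * ((n : ℝ) + 1) ^ (8 * L.card + 3))
          ≤ (∑ U, ∑ M, W U M * (X U * Y M).trace) / r := by
  set ℓ := L.card with hℓ
  set r := dimN n ℓ with hr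
  have hr0 : 0 < r := dimN_pos n ℓ
  have hr0' : (0 : ℝ) < r := by exact_mod_cast hr0
  have hrle : (r : ℝ) ≤ (ℓ + 1) * ((n : ℝ) + 1) ^ (2 * ℓ) := dimN_le n ℓ
  have hΔ := foolBound_pos n ℓ
  obtain ⟨X, Y, hX, hY, hT⟩ :=
    (fool_hasPsdFactorization (n := n) h1).rescale_weak hΔ (fool_le h1 hLn)
  -- the pairing identity `⟨W, T⟩ = ⟨W, S⟩`
  have hWT : ∀ U M, W U M * fool L U M = W U M * pmOddCutSlack n U M := by
    intro U M
    by_cases h : cc U M ∈ L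
    · rw [fool_eq_slack_of_mem h]
    · rw [hW U M h, zero_mul, zero_mul]
  have hval : ∑ U, ∑ M, W U M * (X U * Y M).trace =
      (∑ U, ∑ M, W U M * pmOddCutSlack n U M) / ((r : ℝ) ^ 2 * foolBound n ℓ) := by
    rw [eq_div_iff (by positivity), sum_mul]
    refine sum_congr rfl fun U _ => ?_
    rw [sum_mul]
    refine sum_congr rfl fun M _ => ?_
    rw [← hWT U M, hT U M]; ring
  refine ⟨r, hr0, hrle, X, Y, ⟨hX, hY, fun U M hcc => ?_⟩, ?_⟩
  · -- tight-orthogonality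
    have h0 : fool L U M = 0 := fool_eq_zero_of_cc_eq_one L hcc
    rw [hT U M] at h0
    have htr : (X U * Y M).trace = 0 := by
      rcases mul_eq_zero.1 h0 with h | h
      · exact absurd h (by positivity)
      · exact h
    exact (trace_mul_eq_zero_iff (hX U).1 (hY M).1).1 htr
  · -- the value
    rw [hval, div_div]
    set V := ∑ U, ∑ M, W U M * pmOddCutSlack n U M with hV
    have hden : (r : ℝ) ^ 2 * foolBound n ℓ * r ≤ ((ℓ : ℝ) + 1) ^ 5 * ((n : ℝ) + 1) ^ (8 * ℓ + 3) := by
      have hr3 : (r : ℝ) ^ 3 ≤ ((ℓ + 1) * ((n : ℝ) + 1) ^ (2 * ℓ)) ^ 3 :=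
        pow_le_pow_left₀ hr0'.le hrle 3
      calc (r : ℝ) ^ 2 * foolBound n ℓ * r = (r : ℝ) ^ 3 * foolBound n ℓ := by ring
        _ ≤ ((ℓ + 1) * ((n : ℝ) + 1) ^ (2 * ℓ)) ^ 3 * foolBound n ℓ :=
            mul_le_mul_of_nonneg_right hr3 hΔ.le
        _ = ((ℓ : ℝ) + 1) ^ 5 * ((n : ℝ) + 1) ^ (8 * ℓ + 3) := by unfold foolBound; ring
    exact div_le_div_of_nonneg_left hpos (by positivity) hden

/-- **Level-count obstruction (N3), as the failure of tracial decay.** For a weight on `|L| = ℓ` crossing levels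
(`1 ∉ L`) and any `γ < ⟨W,S⟩ / ((ℓ+1)^5 (n+1)^{8ℓ+3})`, the decay hypothesis `TracialValueLEAt W γ r` fails at some
dimension `r ≤ (ℓ+1)(n+1)^{2ℓ}`: a certificate with such a weight excludes psd factorizations of size `n^{O(ℓ)}` only. -/
theorem not_tracialValueLEAt_of_levels (L : Finset ℕ) (h1 : 1 ∉ L) (hLn : ∀ c ∈ L, c ≤ n)
    (W : OddSet n → PMatch n → ℝ) (hW : ∀ U M, cc U M ∉ L → W U M = 0)
    (hpos : 0 ≤ ∑ U, ∑ M, W U M * pmOddCutSlack n U M) {γ : ℝ}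
    (hγ : γ < (∑ U, ∑ M, W U M * pmOddCutSlack n U M) /
            (((L.card : ℝ) + 1) ^ 5 * ((n : ℝ) + 1) ^ (8 * L.card + 3))) :
    ∃ r : ℕ, 0 < r ∧ (r : ℝ) ≤ (L.card + 1) * ((n : ℝ) + 1) ^ (2 * L.card) ∧
      ¬ TracialValueLEAt W γ r := by
  obtain ⟨r, hr0, hrle, X, Y, hXY, hval⟩ := levelCount_obstruction L h1 hLn W hW hpos
  exact ⟨r, hr0, hrle, fun h => by linarith [h X Y hXY]⟩

/-! ### §7 The route's multilevel design weights -/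

/-- `levelWeight n t L w` is supported on the levels of `L`. -/
theorem levelWeight_eq_zero_of_not_mem {t : ℕ} {L : Finset ℕ} {w : ℕ → ℝ} {U : OddSet n} {M : PMatch n}
    (h : cc U M ∉ L) : levelWeight n t L w U M = 0 := by
  unfold levelWeight
  refine sum_eq_zero fun c hc => ?_
  rw [if_neg]
  intro hq
  rw [mem_Qset_iff] at hq
  exact h (hq.2 ▸ hc)

/-- `⟨levelWeight, S⟩ = Σ_c w_c (c − 1)` when the level classes are nonempty (double count; the same
identity as `Summit.PneNP.PneNP.Theorems.ChebyshevTracialDesignAssembly.sum_levelWeight_mul_slack`, re-proved here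
to keep this file independent of the route file). -/
theorem sum_levelWeight_mul_slack' {t : ℕ} {L : Finset ℕ} {w : ℕ → ℝ}
    (hne : ∀ c ∈ L, (Qset n t c).Nonempty) :
    ∑ U, ∑ M, levelWeight n t L w U M * pmOddCutSlack n U M = ∑ c ∈ L, w c * ((c : ℝ) - 1) := by
  calc ∑ U, ∑ M, levelWeight n t L w U M * pmOddCutSlack n U M
      = ∑ U, ∑ M, ∑ c ∈ L,
          (if (U, M) ∈ Qset n t c then w c / ((Qset n t c).card : ℝ) * pmOddCutSlack n U M else 0) := by
        refine sum_congr rfl fun U _ => sum_congr rfl fun M _ => ?_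
        rw [levelWeight, sum_mul]
        exact sum_congr rfl fun c _ => by split_ifs <;> simp
    _ = ∑ U, ∑ c ∈ L, ∑ M,
          (if (U, M) ∈ Qset n t c then w c / ((Qset n t c).card : ℝ) * pmOddCutSlack n U M else 0) :=
        sum_congr rfl fun U _ => sum_comm
    _ = ∑ c ∈ L, ∑ U, ∑ M,
          (if (U, M) ∈ Qset n t c then w c / ((Qset n t c).card : ℝ) * pmOddCutSlack n U M else 0) :=
        sum_comm
    _ = ∑ c ∈ L, w c * ((c : ℝ) - 1) := by
        refine sum_congr rfl fun c hc => ?_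
        rw [sum_sum_ite_mem (Qset n t c) fun U M => w c / ((Qset n t c).card : ℝ) * pmOddCutSlack n U M]
        have hval : ∀ p ∈ Qset n t c, w c / ((Qset n t c).card : ℝ) * pmOddCutSlack n p.1 p.2 =
            w c / ((Qset n t c).card : ℝ) * ((c : ℝ) - 1) := by
          intro p hp
          rw [pmOddCutSlack, (mem_Qset_iff.1 hp).2]
        rw [sum_congr rfl hval, sum_const, nsmul_eq_mul]
        have hcard : ((Qset n t c).card : ℝ) ≠ 0 := by
          exact_mod_cast (card_pos.2 (hne c hc)).ne'
        field_simp

/-- **The multilevel design weights of the route are fooled in dimension `n^{O(|L|)}`**: if the level classes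
`Q_c(t)`, `c ∈ L` (`1 ∉ L`, levels `≤ n`), are nonempty and `Σ_c w_c (c − 1) ≥ 0`, then for every
`γ < (Σ_c w_c (c−1)) / ((ℓ+1)^5 (n+1)^{8ℓ+3})` the hypothesis `TracialValueLEAt (levelWeight n t L w) γ r` fails at
some `r ≤ (ℓ+1)(n+1)^{2ℓ}` (`ℓ = |L|`). For an exact design `Σ_c w_c (c−1) = 1`, so its tracial decay can only hold
beyond dimension `n^{Θ(|L|)}` — the reason the route's designs carry `|L| ≍ n^{1/4}` levels. -/
theorem levelWeight_fooled {t : ℕ} (L : Finset ℕ) (w : ℕ → ℝ) (h1 : 1 ∉ L) (hLn : ∀ c ∈ L, c ≤ n)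
    (hne : ∀ c ∈ L, (Qset n t c).Nonempty) (hpos : 0 ≤ ∑ c ∈ L, w c * ((c : ℝ) - 1)) {γ : ℝ}
    (hγ : γ < (∑ c ∈ L, w c * ((c : ℝ) - 1)) / (((L.card : ℝ) + 1) ^ 5 * ((n : ℝ) + 1) ^ (8 * L.card + 3))) :
    ∃ r : ℕ, 0 < r ∧ (r : ℝ) ≤ (L.card + 1) * ((n : ℝ) + 1) ^ (2 * L.card) ∧
      ¬ TracialValueLEAt (levelWeight n t L w) γ r := by
  have hS := sum_levelWeight_mul_slack' (n := n) (t := t) (L := L) (w := w) hne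
  refine not_tracialValueLEAt_of_levels L h1 hLn (levelWeight n t L w)
    (fun U M h => levelWeight_eq_zero_of_not_mem h) (by rw [hS]; exact hpos) (by rwa [hS])

end Summit.PneNP.PneNP.Theorems.ChebyshevTracialDesignLevelCount

end
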